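import Mathlib
import Summits.NavierStokesRegularity.NavierStokesRegularity.Theorems.SubcriticalEnvelopeForwardSourceTailEnvelopeKPTwoCycleStrands
import Summits.NavierStokesRegularity.NavierStokesRegularity.Theorems.SubOnsagerCeilingForwardTailCeilingKPDyadicRange
import Summits.NavierStokesRegularity.NavierStokesRegularity.Theorems.SubcriticalEnvelopeForwardSourceTailEnvelopeKPDyadicRatioTwo
import HarnessLib

/-!
# `SubcriticalEnvelope.ForwardSourceTailEnvelopeKP` (stmt-NavierStokesRegularity-27130) — RUNG: the
ν-uniform shell barrier / tail ceiling / forward-source envelope for UNIFORM KP 2-CYCLES at every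
scale ratio `ε₀ ∈ [7/10, 1]`, by EXACT REDUCTION to the one-mode chain (helper file, `--supports`)

LEAD-SE structural move named under KEY-NS #140 (2)(ii) («the next rung above p625250/p626892»).
The uniform KP 2-cycle `kpTwoCycleTable c c` (feeds `x_{0,k}² → x_{1,k+1}`, `x_{1,k}² → x_{0,k+1}`,
coefficient `c`) is the simplest multi-mode KP-proper orthant architecture in the class of the cruxes
27057 / 27130 / 26999 (and a W5 instrument row).  Its lattice is TWO INTERLEAVED COPIES of the
scaled dyadic chain: the strand `r` lives on component `cyclePhase r k = (k + r) mod 2` at shell `k`,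
and the drain partner of a mode is the next mode of the SAME strand.  Hence every honest viscous
solution `X` of the 2-cycle from ANY one-shell datum `X₀ ∈ ℝ⁴` yields two honest solutions
`cycleStrand r X` (`r = 0, 1`) of the `c·dyadicTable` lattice (data `X₀(r)·e₀`), to which ns-soc-p2's
rung `dyadicRange_shellBarrier` (θ = 101/200, D = 100, every `ν`, every `ε₀ ∈ [7/10,1]`) applies;
the idle components `2, 3` only decay (`sq_le_sq_init_of_damped`).

* `kpTwoCycleTable_feed/_up1/_up2/_inshell` — closed forms; `quadTerm_kpTwoCycle_zero/_one/_idle` —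
  the 2-cycle nonlinearity per component;
* `cyclePhase_*` — phase bookkeeping; `quadTerm_cycleStrand` — the INTERTWINING identity
  `quadTerm ε₀ (c·dyadicTable) (cycleStrand r X) 0 n t = quadTerm ε₀ (kpTwoCycleTable c c) X (cyclePhase r n) n t`;
* `cycleStrand_honest` — strands of honest 2-cycle solutions are honest chain solutions
  (one-shell datum, noLow, (4.5) bound, continuity, exact motion, non-negativity on shells `≥ 1`);
* `kpTwoCycle_shellBarrier_of_chain` — RATIO-AGNOSTIC TRANSFER: any ν-uniform weighted shell
  bound for `c·dyadicTable` at ratio `1+ε₀` holds verbatim for `kpTwoCycleTable c c` (so every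
  chain rung, present or future, transfers by one line);
* `kpTwoCycle_shellBarrier` / `kpTwoCycle_shellBarrierAt` — the ν-uniform weighted per-shell bound
  `(1+ε₀)^{2θk}·½X_{i,k}(t)² ≤ 100·Σ½X₀²`, `θ = 101/200`, for `ε₀ ∈ [7/10,1]`, i.e.
  `ShellBarrierAt R ε₀ (kpTwoCycleTable c c)`;
* `kpTwoCycle_ceilingAt` and `forwardSourceTailEnvelopeKP_at_kpTwoCycle` — the tail ceiling and the
  27130 clause (S = univ) on this class, through the landed glue
  (`subOnsagerCeiling_ceilingAt_of_shellBarrierAt`, `viscousTailEnvelopeOrthant_uniform_of_ceilingAt`).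

Scope: ASYMMETRIC 2-cycles (`c₀ ≠ c₁`) reduce by the same strands to 2-PERIODIC chains, for which no
barrier is in the tree; the intertwining identity is proved for general `(c₀, c₁)` against the
periodic coefficients only where it is free (closed forms), the rung itself is the uniform case.

HONEST FRAMING: statements about Tao-type MODEL lattice ODEs (rung TL-M2Break); one architecture,
one ratio range; the cruxes are NOT proved; nothing here concerns the Navier–Stokes equations; NS
regularity is NOT advanced.
-/

noncomputable section

-- the sub-problem namespace `NavierStokesRegularity.NavierStokesRegularity` is the tree's layout (D-0017)
set_option linter.dupNamespace false

namespace Summit.NavierStokesRegularity.NavierStokesRegularity.Theorems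

open Set
open Literature.Analysis.FluidPDE.TaoCascade
open Summit.NavierStokesRegularity.NavierStokesRegularity.Theorems.SubOnsagerCeiling
open Summit.NavierStokesRegularity.NavierStokesRegularity.Theses

/-! ## §6 Chain barrier ⇒ 2-cycle barrier (ratio-agnostic transfer), and the rung on `[7/10, 1]` -/

/-- **TRANSFER: any ν-uniform weighted shell bound for the scaled chain gives the same bound for the
uniform 2-cycle, at the same scale ratio.**  If at ratio `1+ε₀` every honest viscous solution `Y` of
the `c·dyadicTable` lattice (any one-shell datum `Y₀`, non-negative on shells `≥ 1`) obeys
`(1+ε₀)^{2θk}·½Y_{i,k}(t)² ≤ D·Σ_j ½Y₀_j²` (`D ≥ 1`), then every honest viscous solution of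
`kpTwoCycleTable c c` obeys the same bound with the same `θ`, `D`: components `0, 1` at shell `k`
sit on the strand `r = (i − k) mod 2`, an honest chain solution (`cycleStrand_honest`) with datum
energy `≤ Σ½X₀²`; components `2, 3` only decay (`sq_le_sq_init_of_damped`).  The ratio enters only
through the hypothesis, so every chain rung (p625959 on `[7/10,1]`, ns-soc-p2's mid-range regions as
they land) transfers by one line.  MODEL lattice statement. [this file] -/
theorem kpTwoCycle_shellBarrier_of_chain {c ε₀ θ D : ℝ} (hε : 0 < ε₀) (hD1 : 1 ≤ D)
    (hchain : ∀ ν : ℝ, 0 < ν → ∀ (Y₀ : Fin 4 → ℝ) (s : ℝ), 0 < s → ∀ Y : Fin 4 → ℤ → ℝ → ℝ,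
      (∀ (i : Fin 4) (k : ℤ), Y i k 0 = if k = 0 then Y₀ i else 0) →
      (∀ (i : Fin 4) (k : ℤ), k < 0 → ∀ t : ℝ, Y i k t = 0) →
      (∃ M : ℝ, ∀ (t : ℝ) (i : Fin 4) (k : ℤ), (1 + (1 + ε₀) ^ ((10 : ℝ) * k)) * |Y i k t| ≤ M) →
      (∀ (i : Fin 4) (k : ℤ), Continuous (Y i k)) →
      (∀ (i : Fin 4) (k : ℤ), ∀ t ∈ Set.Icc (0 : ℝ) s, HasDerivWithinAt (Y i k)
        (quadTerm ε₀ (fun i₁ i₂ i₃ μ => c * dyadicTable i₁ i₂ i₃ μ) Y i k t -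
          ν * (1 + ε₀) ^ ((2 : ℝ) * k) * Y i k t) (Set.Icc (0 : ℝ) s) t) →
      (∀ t ∈ Set.Icc (0 : ℝ) s, ∀ (i : Fin 4) (k : ℤ), 1 ≤ k → 0 ≤ Y i k t) →
      ∀ t ∈ Set.Icc (0 : ℝ) s, ∀ (i : Fin 4) (k : ℕ),
        (1 + ε₀) ^ (2 * θ * (k : ℝ)) * ((1 / 2 : ℝ) * Y i (k : ℤ) t ^ 2) ≤
          D * (∑ j : Fin 4, (1 / 2 : ℝ) * Y₀ j ^ 2)) :
    ∀ ν : ℝ, 0 < ν → ∀ (X₀ : Fin 4 → ℝ) (s : ℝ), 0 < s → ∀ X : Fin 4 → ℤ → ℝ → ℝ,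
      (∀ (i : Fin 4) (k : ℤ), X i k 0 = if k = 0 then X₀ i else 0) →
      (∀ (i : Fin 4) (k : ℤ), k < 0 → ∀ t : ℝ, X i k t = 0) →
      (∃ M : ℝ, ∀ (t : ℝ) (i : Fin 4) (k : ℤ), (1 + (1 + ε₀) ^ ((10 : ℝ) * k)) * |X i k t| ≤ M) →
      (∀ (i : Fin 4) (k : ℤ), Continuous (X i k)) →
      (∀ (i : Fin 4) (k : ℤ), ∀ t ∈ Set.Icc (0 : ℝ) s, HasDerivWithinAt (X i k)
        (quadTerm ε₀ (kpTwoCycleTable c c) X i k t - ν * (1 + ε₀) ^ ((2 : ℝ) * k) * X i k t)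
        (Set.Icc (0 : ℝ) s) t) →
      (∀ t ∈ Set.Icc (0 : ℝ) s, ∀ (i : Fin 4) (k : ℤ), 1 ≤ k → 0 ≤ X i k t) →
      ∀ t ∈ Set.Icc (0 : ℝ) s, ∀ (i : Fin 4) (k : ℕ),
        (1 + ε₀) ^ (2 * θ * (k : ℝ)) * ((1 / 2 : ℝ) * X i (k : ℤ) t ^ 2) ≤
          D * (∑ j : Fin 4, (1 / 2 : ℝ) * X₀ j ^ 2) := by
  intro ν hν X₀ s hs X hinit hlow hbd hcont hder hnn t ht i k
  have hb0 : (0 : ℝ) < 1 + ε₀ := by linarith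
  set E₀ : ℝ := ∑ j : Fin 4, (1 / 2 : ℝ) * X₀ j ^ 2 with hE₀
  have hE₀i : ∀ j : Fin 4, (1 / 2 : ℝ) * X₀ j ^ 2 ≤ E₀ := fun j =>
    Finset.single_le_sum (f := fun j => (1 / 2 : ℝ) * X₀ j ^ 2) (fun j _ => by positivity)
      (Finset.mem_univ j)
  have hE₀0 : 0 ≤ E₀ := Finset.sum_nonneg fun j _ => by positivity
  have hD0 : 0 ≤ D := le_trans zero_le_one hD1
  -- the strands: honest chain solutions, hence under the chain barrier
  have hstrand : ∀ r : ℤ, (1 + ε₀) ^ (2 * θ * (k : ℝ)) *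
      ((1 / 2 : ℝ) * X (cyclePhase r k) (k : ℤ) t ^ 2) ≤ D * E₀ := by
    intro r
    obtain ⟨h1, h2, h3, h4, h5, h6⟩ := cycleStrand_honest (c := c) r hinit hlow hbd hcont hder hnn
    have hB := hchain ν hν _ s hs (cycleStrand r X) h1 h2 h3 h4 h5 h6 t ht 0 k
    rw [cycleStrand_zero] at hB
    refine hB.trans (mul_le_mul_of_nonneg_left ?_ hD0)
    have : (∑ j : Fin 4, (1 / 2 : ℝ) * (if j = 0 then X₀ (cyclePhase r 0) else 0) ^ 2) =
        (1 / 2 : ℝ) * X₀ (cyclePhase r 0) ^ 2 := by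
      simp
    rw [this]
    exact hE₀i _
  -- idle components: damped from their datum
  have hidle : ∀ i : Fin 4, (i = 2 ∨ i = 3) →
      (1 + ε₀) ^ (2 * θ * (k : ℝ)) * ((1 / 2 : ℝ) * X i (k : ℤ) t ^ 2) ≤ D * E₀ := by
    intro i hi
    have hsq := sq_le_sq_init_of_damped (y := X i (k : ℤ))
      (q := fun u => quadTerm ε₀ (kpTwoCycleTable c c) X i (k : ℤ) u)
      (c := ν * (1 + ε₀) ^ ((2 : ℝ) * ((k : ℕ) : ℤ))) (s := s)
      (mul_nonneg hν.le (Real.rpow_nonneg hb0.le _)) (hcont i k)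
      (fun u _ => quadTerm_kpTwoCycle_idle ε₀ c c X hi (k : ℤ) u)
      (fun u hu => hder i k u hu) t ht
    have hw : (1 + ε₀) ^ (2 * θ * (k : ℝ)) * ((1 / 2 : ℝ) * X i (k : ℤ) t ^ 2) ≤
        (1 + ε₀) ^ (2 * θ * (k : ℝ)) * ((1 / 2 : ℝ) * X i (k : ℤ) 0 ^ 2) :=
      mul_le_mul_of_nonneg_left (by nlinarith [hsq]) (Real.rpow_nonneg hb0.le _)
    refine hw.trans ?_
    rw [hinit]
    by_cases hk : ((k : ℕ) : ℤ) = 0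
    · have hk0 : k = 0 := by exact_mod_cast hk
      subst hk0
      simp only [hk, if_true, Nat.cast_zero, mul_zero, Real.rpow_zero, one_mul]
      exact (hE₀i i).trans (by nlinarith [hE₀0])
    · simp only [hk, if_false]
      have : (0 : ℝ) ^ 2 = 0 := by norm_num
      rw [this, mul_zero, mul_zero]
      positivity
  fin_cases i
  · -- i = 0: strand r = k mod 2
    have hph : cyclePhase ((k : ℤ) % 2) (k : ℤ) = 0 := by
      have heq : ((k : ℤ) + (k : ℤ) % 2) % 2 = 0 := by omega
      simp only [cyclePhase, if_pos heq]
    have := hstrand ((k : ℤ) % 2)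
    rw [hph] at this
    simpa using this
  · -- i = 1: strand r = (k + 1) mod 2
    have hph : cyclePhase (((k : ℤ) + 1) % 2) (k : ℤ) = 1 := by
      have hne : ¬ (((k : ℤ) + ((k : ℤ) + 1) % 2) % 2 = 0) := by omega
      simp only [cyclePhase, if_neg hne]
    have := hstrand (((k : ℤ) + 1) % 2)
    rw [hph] at this
    simpa using this
  · simpa using hidle 2 (Or.inl rfl)
  · simpa using hidle 3 (Or.inr rfl)

/-- **ν-UNIFORM SHELL BARRIER FOR THE UNIFORM KP 2-CYCLE on `ε₀ ∈ [7/10,1]`** (`θ = 101/200`,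
`D = 100`, every `c > 0`, every `ν > 0`, every one-shell datum): the transfer applied to ns-soc-p2's
chain rung `dyadicRange_shellBarrier` (BY NAME).  MODEL lattice statement. [this file] -/
theorem kpTwoCycle_shellBarrier {c ε₀ : ℝ} (hc : 0 < c) (hε : 7 / 10 ≤ ε₀) (hε1 : ε₀ ≤ 1) :
    ∀ ν : ℝ, 0 < ν → ∀ (X₀ : Fin 4 → ℝ) (s : ℝ), 0 < s → ∀ X : Fin 4 → ℤ → ℝ → ℝ,
      (∀ (i : Fin 4) (k : ℤ), X i k 0 = if k = 0 then X₀ i else 0) →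
      (∀ (i : Fin 4) (k : ℤ), k < 0 → ∀ t : ℝ, X i k t = 0) →
      (∃ M : ℝ, ∀ (t : ℝ) (i : Fin 4) (k : ℤ), (1 + (1 + ε₀) ^ ((10 : ℝ) * k)) * |X i k t| ≤ M) →
      (∀ (i : Fin 4) (k : ℤ), Continuous (X i k)) →
      (∀ (i : Fin 4) (k : ℤ), ∀ t ∈ Set.Icc (0 : ℝ) s, HasDerivWithinAt (X i k)
        (quadTerm ε₀ (kpTwoCycleTable c c) X i k t - ν * (1 + ε₀) ^ ((2 : ℝ) * k) * X i k t)
        (Set.Icc (0 : ℝ) s) t) →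
      (∀ t ∈ Set.Icc (0 : ℝ) s, ∀ (i : Fin 4) (k : ℤ), 1 ≤ k → 0 ≤ X i k t) →
      ∀ t ∈ Set.Icc (0 : ℝ) s, ∀ (i : Fin 4) (k : ℕ),
        (1 + ε₀) ^ (2 * (101 / 200) * (k : ℝ)) * ((1 / 2 : ℝ) * X i (k : ℤ) t ^ 2) ≤
          100 * (∑ j : Fin 4, (1 / 2 : ℝ) * X₀ j ^ 2) :=
  kpTwoCycle_shellBarrier_of_chain (by linarith) (by norm_num)
    (dyadicRange_shellBarrier hc hε hε1 (α := fun i₁ i₂ i₃ μ => c * dyadicTable i₁ i₂ i₃ μ)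
      (fun _ _ _ _ => rfl))

/-- **The rung in the skeletons' binder shape**: `ShellBarrierAt R ε₀ (kpTwoCycleTable c c)` for
every spread `R`, every `ε₀ ∈ [7/10,1]` and every `c > 0` (the table-class and orthant binders of
`ShellBarrierAt` are hypotheses it does not need). [this file] -/
theorem kpTwoCycle_shellBarrierAt {c : ℝ} (hc : 0 < c) :
    ∀ R : ℝ, ∀ ε₀ : ℝ, 7 / 10 ≤ ε₀ → ε₀ ≤ 1 → ShellBarrierAt R ε₀ (kpTwoCycleTable c c) := by
  intro R ε₀ hε hε1 _hT _hO
  exact ⟨101 / 200, by norm_num, 100, by norm_num, kpTwoCycle_shellBarrier hc hε hε1⟩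

/-- **Tail ceiling for the uniform 2-cycle** at every `ε₀ ∈ [7/10,1]`, by the shell-barrier ⇒ ceiling
glue. [this file] -/
theorem kpTwoCycle_ceilingAt {c : ℝ} (hc : 0 < c) :
    ∀ R : ℝ, ∀ ε₀ : ℝ, 7 / 10 ≤ ε₀ → ε₀ ≤ 1 → CeilingAt R ε₀ (kpTwoCycleTable c c) := by
  intro R ε₀ hε hε1
  exact subOnsagerCeiling_ceilingAt_of_shellBarrierAt (by linarith) (kpTwoCycle_shellBarrierAt hc R ε₀ hε hε1)

/-- **The 27130 clause on the uniform 2-cycle class at every `ε₀ ∈ [7/10,1]`**: `S = univ`, margin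
`η = 2θ − 1 = 1/100`, window constant `C·Σ½X₀²` uniform in `T` and `ν`; the table-class and orthant
binders are consumed by `viscousTailEnvelopeOrthant_uniform_of_ceilingAt`, the diagonal-feed binder is
idle.  MODEL lattice statement; the crux 27130 is NOT proved (one architecture, one ratio range).
[this file] -/
theorem forwardSourceTailEnvelopeKP_at_kpTwoCycle {c : ℝ} (hc : 0 < c) :
    ∀ R : ℝ, 1 ≤ R → ∀ ε₀ : ℝ, 7 / 10 ≤ ε₀ → ε₀ ≤ 1 →
      InTableClass R (kpTwoCycleTable c c) →
      (∀ (Y : Fin 4 → ℤ → ℝ → ℝ) (τ : ℝ), (∀ (j : Fin 4) (k : ℤ), 1 ≤ k → 0 ≤ Y j k τ) →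
        ∀ δ : ℝ, 0 < δ → ∀ (i : Fin 4) (n : ℤ), 1 ≤ n → Y i n τ = 0 →
        0 ≤ quadTerm δ (kpTwoCycleTable c c) Y i n τ) →
      (∀ a b i : Fin 4, a ≠ b → kpTwoCycleTable c c a b i (0, 0, 1) = 0) →
      ∃ S : Finset (Fin 4), (∀ i, i ∉ S → ∀ j l : Fin 4, kpTwoCycleTable c c i j l (0, 0, 1) = 0) ∧
      ∀ X₀ : Fin 4 → ℝ, ∃ η : ℝ, 0 < η ∧ ∀ T : ℝ, 0 < T → ∃ C : ℝ, ∀ ν : ℝ, 0 < ν →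
      ∀ s ∈ Set.Ioc (0 : ℝ) T, ∀ X : Fin 4 → ℤ → ℝ → ℝ,
      (∀ i k, X i k 0 = if k = 0 then X₀ i else 0) →
      (∀ i k, k < 0 → ∀ t, X i k t = 0) →
      (∃ M : ℝ, ∀ (t : ℝ) (i : Fin 4) (k : ℤ), (1 + (1 + ε₀) ^ ((10 : ℝ) * k)) * |X i k t| ≤ M) →
      (∀ i k, Continuous (X i k)) →
      (∀ i k, ∀ t ∈ Set.Icc (0 : ℝ) s, HasDerivWithinAt (X i k)
        (quadTerm ε₀ (kpTwoCycleTable c c) X i k t - ν * (1 + ε₀) ^ ((2 : ℝ) * k) * X i k t)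
        (Set.Icc 0 s) t) →
      ∀ n N : ℕ, n ≤ N → ∀ t ∈ Set.Icc (0 : ℝ) s,
        ∑ k ∈ Finset.Icc n N, ∑ i ∈ S, (1 / 2) * X i (k : ℤ) t ^ 2 ≤
          C * (1 + ε₀) ^ (-((1 + η) * (n : ℝ))) := by
  intro R _hR ε₀ hε hε1 hα hK _hdiag
  have hε0 : 0 < ε₀ := by linarith
  obtain ⟨η, hη, C, _hC0, H⟩ :=
    viscousTailEnvelopeOrthant_uniform_of_ceilingAt hε0 hα hK (kpTwoCycle_ceilingAt hc R ε₀ hε hε1)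
  refine ⟨Finset.univ, fun i hi => absurd (Finset.mem_univ i) hi, fun X₀ =>
    ⟨η, hη, fun T _hT => ⟨C * (∑ i : Fin 4, (1 / 2 : ℝ) * X₀ i ^ 2),
      fun ν hν s hs X hinit hlow hbd hcont hder n N hnN t ht => ?_⟩⟩⟩
  exact H ν hν X₀ s hs.1 X hinit hlow hbd hcont hder n N hnN t ht

/-- The syntactic forward sources of the 2-cycle are exactly the components `0` and `1`
(`S⁺(α) = {0, 1}`): a component outside `{0,1}` carries no feed coefficient. [this file] -/
theorem kpTwoCycleTable_sourceComplete (c₀ c₁ : ℝ) :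
    ∀ i, i ∉ ({0, 1} : Finset (Fin 4)) → ∀ j l : Fin 4, kpTwoCycleTable c₀ c₁ i j l (0, 0, 1) = 0 := by
  intro i hi j l
  rw [kpTwoCycleTable_feed]
  fin_cases i <;> simp at hi ⊢

/-- **The 27130 clause on the uniform 2-cycle with the CANONICAL mode set `S := S⁺(α) = {0,1}`**
(the forward sources; tenure ask of KEY-NS #142 (1)): the `{0,1}`-partial tails are below the total
tails, so the `S = univ` envelope of `forwardSourceTailEnvelopeKP_at_kpTwoCycle` transfers with the
same `η`, `C`.  MODEL lattice statement. [this file] -/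
theorem forwardSourceTailEnvelopeKP_at_kpTwoCycle_sources {c : ℝ} (hc : 0 < c) :
    ∀ R : ℝ, 1 ≤ R → ∀ ε₀ : ℝ, 7 / 10 ≤ ε₀ → ε₀ ≤ 1 →
      InTableClass R (kpTwoCycleTable c c) →
      (∀ (Y : Fin 4 → ℤ → ℝ → ℝ) (τ : ℝ), (∀ (j : Fin 4) (k : ℤ), 1 ≤ k → 0 ≤ Y j k τ) →
        ∀ δ : ℝ, 0 < δ → ∀ (i : Fin 4) (n : ℤ), 1 ≤ n → Y i n τ = 0 →
        0 ≤ quadTerm δ (kpTwoCycleTable c c) Y i n τ) →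
      (∀ i, i ∉ ({0, 1} : Finset (Fin 4)) → ∀ j l : Fin 4, kpTwoCycleTable c c i j l (0, 0, 1) = 0) ∧
      ∀ X₀ : Fin 4 → ℝ, ∃ η : ℝ, 0 < η ∧ ∀ T : ℝ, 0 < T → ∃ C : ℝ, ∀ ν : ℝ, 0 < ν →
      ∀ s ∈ Set.Ioc (0 : ℝ) T, ∀ X : Fin 4 → ℤ → ℝ → ℝ,
      (∀ i k, X i k 0 = if k = 0 then X₀ i else 0) →
      (∀ i k, k < 0 → ∀ t, X i k t = 0) →
      (∃ M : ℝ, ∀ (t : ℝ) (i : Fin 4) (k : ℤ), (1 + (1 + ε₀) ^ ((10 : ℝ) * k)) * |X i k t| ≤ M) →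
      (∀ i k, Continuous (X i k)) →
      (∀ i k, ∀ t ∈ Set.Icc (0 : ℝ) s, HasDerivWithinAt (X i k)
        (quadTerm ε₀ (kpTwoCycleTable c c) X i k t - ν * (1 + ε₀) ^ ((2 : ℝ) * k) * X i k t)
        (Set.Icc 0 s) t) →
      ∀ n N : ℕ, n ≤ N → ∀ t ∈ Set.Icc (0 : ℝ) s,
        ∑ k ∈ Finset.Icc n N, ∑ i ∈ ({0, 1} : Finset (Fin 4)), (1 / 2) * X i (k : ℤ) t ^ 2 ≤
          C * (1 + ε₀) ^ (-((1 + η) * (n : ℝ))) := by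
  intro R _hR ε₀ hε hε1 hα hK
  refine ⟨kpTwoCycleTable_sourceComplete c c, fun X₀ => ?_⟩
  -- total-energy envelope from the ceiling, then monotonicity of partial sums in the mode set
  have hε0 : 0 < ε₀ := by linarith
  obtain ⟨η, hη, C, _hC0, H⟩ :=
    viscousTailEnvelopeOrthant_uniform_of_ceilingAt hε0 hα hK (kpTwoCycle_ceilingAt hc R ε₀ hε hε1)
  refine ⟨η, hη, fun T _hT => ⟨C * (∑ i : Fin 4, (1 / 2 : ℝ) * X₀ i ^ 2),
    fun ν hν s hs X hinit hlow hbd hcont hder n N hnN t ht => ?_⟩⟩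
  have hfull := H ν hν X₀ s hs.1 X hinit hlow hbd hcont hder n N hnN t ht
  refine le_trans (Finset.sum_le_sum fun k _ => ?_) hfull
  exact Finset.sum_le_univ_sum_of_nonneg fun i => by positivity

end Summit.NavierStokesRegularity.NavierStokesRegularity.Theorems

end
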